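import Summits.CriticalPhenomena.PercolationContinuityZ3.Theorems.PercNearOneGluingNoHeavyQuantFarRelayRowSpider
import HarnessLib

/-!
# QUANT lane R8 tool: bond percolation with TREE-supported weights is independent vertex gates —
# the cluster-law transfer to `prodBernoulli` on the vertices (bridge for every gate-coordinate row on trees)

builds on p205010 (kernel theorem, internal audit signed; external expert review pending)

Support file (`--supports stmt-CriticalPhenomena-4575`), QUANT lane typer seat prim-quant-stmt (gen 9); companion of
`…QuantFarRelayRowSpider.lean` (p219403: `Quant.farRelayRow_spider`).  Memos: `run/shared/lean/prim/quant/CENSUS-GAIN.md` §14.1/§14.3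
(FAR on trees: census n ≤ 14, what a tree proof must do), `prim-quant-lead-g5/LEAD-NOTES-G5.md` N13, `STATEMENTS.md` §K.
Theorems only; no definitions, no sorries, standard axioms.

The lane's live R8 line is FAR (`Quant.FarRelayRow`) on TREES, attacked in GATE COORDINATES (independent vertices, a relay is reached iff all
its ancestors' gates are open — the setting of `Quant.far_indepLegs`, `Quant.halfMean_smallBall`, CENSUS-GAIN §14.3).  Any theorem proved
there must be carried back to the route's vocabulary (`prodBernoulli w` on the pairs of `Fin n`, events `openConn`).  This file proves that
bridge ONCE, for every rooted tree and every event of the observer's cluster, so that later gate-coordinate rows transfer by a one-line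
specialisation (as `farRelayRow_spider` did by hand for spiders).

**Trees in coordinates.**  A rooted spanning tree of `Fin n` with root `o` is given by `par : Fin n → Fin n` (parent) and `depth : Fin n → ℕ`
with (i) `par x = o` when `depth x = 0` and (ii) otherwise `par x ≠ o` and `depth (par x) + 1 = depth x` (`x ≠ o`; the values at `o` are
irrelevant).  Weights are TREE-SUPPORTED if every pair of nonzero weight is a loop or a parent pair `s(par x, x)`, `x ≠ o`; the parent-pair
weights are arbitrary (weight `0` prunes, so every forest is covered).  Gate parameters: `q x = w s(par x, x)` for `x ≠ o`, `q o = 1`.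

* `Quant.tree_iterate_par` — the ancestors `par^[i] x`, `i ≤ depth x`, stay off the root and `depth (par^[i] x) = depth x − i`.
* `Quant.openWalk_tree_invariant` / `Quant.mem_openConn_of_tree_gates` — on a configuration whose open non-loop pairs are parent pairs,
  `o ↔ a` iff every parent pair `s(par^[i+1] a, par^[i] a)`, `i ≤ depth a`, is open (walk induction / depth induction; the spider versions
  of `…QuantFarRelayRowSpider.lean` without legs).
* `Quant.tree_cluster_transfer` — **the transfer**: for tree-supported `w` and EVERY set `S` of vertex sets,
  `P_w({a | o ↔ a} ∈ S) = P_q({a | a = o ∨ ∀ i ≤ depth a, par^[i] a ∈ ω'} ∈ S)`, `P_q = prodBernoulli q` on `Set (Fin n)`: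
  the observer's cluster has the law of the set of vertices whose whole ancestral line of gates is open, gates independent.  Proof:
  weight-`0` pairs are a.s. closed; the reading `ω ↦ {x | x = o ∨ s(par x, x) ∈ ω}` is `prodBernoulli q` by the block principle
  (`prodBernoulli_real_preimage_readBlocks`, blocks = child vertex, `spider_gate_injective`); compose with the a.s. identity above.
* `Quant.tree_real_openConn_eq_prod` — corollary: `P_w(o ↔ a) = ∏_{i ≤ depth a} w s(par^[i+1] a, par^[i] a)` (product along the path).
* `Quant.tree_relayCount_transfer` — corollary in the shape of the lane's rows: for every `A`, `j`,
  `P_w(#{a ∈ A | o ↔ a} ≤ j) = P_q(#{a ∈ A | a = o ∨ all ancestors' gates of a open} ≤ j)`.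
[cite: KozmaNitzan2024, Conjecture 3 (p. 15)] (context: the finite-graph gluing rows this transfer serves); the transfer itself is the
elementary independence structure of percolation on a tree [cite: Grimmett1999, §1.3 p. 10 (product measure); §10.1 (trees)].
-/

noncomputable section

namespace Summit.CriticalPhenomena.PercolationContinuityZ3.Theorems

namespace Quant

open Finset MeasureTheory
open Literature.Probability.LatticeModels
open Literature.Probability.Percolation
open scoped Classical

variable {n : ℕ}

/-- In a rooted tree (`par`, `depth`; root `o`), the ancestors `par^[i] x` (`i ≤ depth x`) of a vertex `x ≠ o` are not the root and
`depth (par^[i] x) + i = depth x`. [this work] -/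
theorem tree_iterate_par (o : Fin n) (depth : Fin n → ℕ) (par : Fin n → Fin n)
    (hstep : ∀ x, x ≠ o → depth x ≠ 0 → par x ≠ o ∧ depth (par x) + 1 = depth x)
    (x : Fin n) (hx : x ≠ o) : ∀ i, i ≤ depth x → par^[i] x ≠ o ∧ depth (par^[i] x) + i = depth x := by
  intro i
  induction i with
  | zero => intro _; exact ⟨hx, by simp⟩
  | succ i ih =>
    intro hi
    obtain ⟨h1, h2⟩ := ih (by omega)
    have hd : depth (par^[i] x) ≠ 0 := by omega
    obtain ⟨h3, h4⟩ := hstep _ h1 hd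
    refine ⟨by rw [Function.iterate_succ_apply']; exact h3, ?_⟩
    rw [Function.iterate_succ_apply']
    omega

/-- **Walk invariant of a tree configuration.**  If every open non-loop pair of `ω` is a parent pair `s(par x, x)` (`x ≠ o`), then along any
open walk the property '`v = o`, or `v ≠ o` and all the parent pairs `s(par^[i+1] v, par^[i] v)`, `i ≤ depth v`, are open' propagates from
the start to the end of the walk. [this work] -/
theorem openWalk_tree_invariant (o : Fin n) (depth : Fin n → ℕ) (par : Fin n → Fin n)
    (hroot : ∀ x, x ≠ o → depth x = 0 → par x = o)
    (hstep : ∀ x, x ≠ o → depth x ≠ 0 → par x ≠ o ∧ depth (par x) + 1 = depth x)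
    (ω : BondConfig (Fin n))
    (hω : ∀ u v, u ≠ v → s(u, v) ∈ ω → ∃ x, x ≠ o ∧ s(u, v) = s(par x, x)) :
    ∀ (u v : Fin n) (q : (openGraph ω).Walk u v),
      (u = o ∨ (u ≠ o ∧ ∀ i, i ≤ depth u → s(par (par^[i] u), par^[i] u) ∈ ω)) →
      (v = o ∨ (v ≠ o ∧ ∀ i, i ≤ depth v → s(par (par^[i] v), par^[i] v) ∈ ω)) := by
  intro u v q
  induction q with
  | nil => exact id
  | cons hadj q' ih =>
    rename_i u' x v'
    intro hu
    apply ih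
    rw [openGraph_adj] at hadj
    obtain ⟨hmem, hux⟩ := hadj
    obtain ⟨z, hzo, hz⟩ := hω u' x hux hmem
    rcases Sym2.eq_iff.1 hz with ⟨hu'z, hxz⟩ | ⟨hu'z, hxz⟩
    · -- `u' = par z`, `x = z`: the step moves away from the root
      right
      refine ⟨hxz ▸ hzo, fun i hi => ?_⟩
      rw [hxz] at hi ⊢
      rcases Nat.eq_zero_or_pos i with hi0 | hipos
      · rw [hi0, Function.iterate_zero_apply, ← hz]
        exact hmem
      · have hdz : depth z ≠ 0 := by omega
        obtain ⟨hpo, hpd⟩ := hstep z hzo hdz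
        rcases hu with hu | ⟨-, hu⟩
        · exact absurd (hu'z.symm.trans hu) hpo
        · obtain ⟨k, rfl⟩ : ∃ k, i = k + 1 := ⟨i - 1, by omega⟩
          have hk := hu k (by rw [hu'z]; omega)
          rw [hu'z] at hk
          rw [Function.iterate_succ_apply]
          exact hk
    · -- `u' = z`, `x = par z`: the step moves towards the root
      by_cases hpo : par z = o
      · exact Or.inl (hxz.trans hpo)
      · right
        have hdz : depth z ≠ 0 := fun hd => hpo (hroot z hzo hd)
        obtain ⟨-, hpd⟩ := hstep z hzo hdz
        refine ⟨fun hxo => hpo (hxz ▸ hxo), fun i hi => ?_⟩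
        rw [hxz] at hi ⊢
        rcases hu with hu | ⟨-, hu⟩
        · exact absurd (hu'z.symm.trans hu) hzo
        · have hk := hu (i + 1) (by rw [hu'z]; omega)
          rw [hu'z, Function.iterate_succ_apply] at hk
          exact hk

/-- **Open ancestral line gives connection (trees).**  If all the parent pairs `s(par^[i+1] a, par^[i] a)`, `i ≤ depth a`, of a vertex
`a ≠ o` are open in `ω`, then `o ↔ a` in `ω` (induction on the depth). [this work] -/
theorem mem_openConn_of_tree_gates (o : Fin n) (depth : Fin n → ℕ) (par : Fin n → Fin n)
    (hroot : ∀ x, x ≠ o → depth x = 0 → par x = o)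
    (hstep : ∀ x, x ≠ o → depth x ≠ 0 → par x ≠ o ∧ depth (par x) + 1 = depth x)
    (ω : BondConfig (Fin n)) (a : Fin n) (hao : a ≠ o)
    (h : ∀ i, i ≤ depth a → s(par (par^[i] a), par^[i] a) ∈ ω) :
    ω ∈ openConn o a := by
  have key : ∀ (d : ℕ) (y : Fin n), y ≠ o → depth y = d →
      (∀ i, i ≤ depth y → s(par (par^[i] y), par^[i] y) ∈ ω) → (openGraph ω).Reachable o y := by
    intro d
    induction d with
    | zero =>
      intro y hyo hd0 hy
      have hpy := hroot y hyo hd0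
      have hadj : (openGraph ω).Adj o y := by
        rw [openGraph_adj]
        refine ⟨?_, fun h' => hyo h'.symm⟩
        have h0 := hy 0 (Nat.zero_le _)
        rwa [Function.iterate_zero_apply, hpy] at h0
      exact hadj.reachable
    | succ d ih =>
      intro y hyo hdS hy
      obtain ⟨hpo, hpd⟩ := hstep y hyo (by omega)
      have hreach : (openGraph ω).Reachable o (par y) :=
        ih (par y) hpo (by omega) fun i hi => by
          have h1 := hy (i + 1) (by omega)
          rwa [Function.iterate_succ_apply] at h1
      have hadj : (openGraph ω).Adj (par y) y := by
        rw [openGraph_adj]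
        refine ⟨?_, fun h' => ?_⟩
        · have h0 := hy 0 (Nat.zero_le _)
          rwa [Function.iterate_zero_apply] at h0
        · rw [h'] at hpd
          omega
      exact hreach.trans hadj.reachable
  exact key (depth a) a hao rfl h

/-- **Cluster-law transfer for tree-supported weights.**  Data: a rooted spanning tree of `Fin n` in coordinates (`par`, `depth`, root `o`:
`par x = o` at depth `0`, else `par x ≠ o` one level up) and weights all of whose nonzero values sit on loops or parent pairs `s(par x, x)`,
`x ≠ o`.  Then for EVERY set `S` of vertex sets, `P_w({a | o ↔ a} ∈ S) = P_q({a | a = o ∨ ∀ i ≤ depth a, par^[i] a ∈ ω'} ∈ S)`, where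
`P_q = prodBernoulli q` on the vertices with `q x = w s(par x, x)` (`x ≠ o`), `q o = 1`: the observer's open cluster has the law of the set of
vertices whose whole ancestral line of independent gates is open.  Proof: weight-`0` pairs are a.s. closed; on such configurations
`o ↔ a` iff the ancestral parent pairs of `a` are open (`openWalk_tree_invariant`, `mem_openConn_of_tree_gates`); the gate reading is
`prodBernoulli q` by the block principle `prodBernoulli_real_preimage_readBlocks`.
builds on p205010 (kernel theorem, internal audit signed; external expert review pending). [this work] -/
theorem tree_cluster_transfer (n : ℕ) (w : Sym2 (Fin n) → unitInterval) (o : Fin n) (depth : Fin n → ℕ)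
    (par : Fin n → Fin n)
    (hroot : ∀ x, x ≠ o → depth x = 0 → par x = o)
    (hstep : ∀ x, x ≠ o → depth x ≠ 0 → par x ≠ o ∧ depth (par x) + 1 = depth x)
    (hsupp : ∀ e, w e ≠ 0 → e.IsDiag ∨ ∃ x, x ≠ o ∧ e = s(par x, x))
    (S : Set (Set (Fin n))) :
    (prodBernoulli w).real {ω : BondConfig (Fin n) | {a | ω ∈ openConn o a} ∈ S} =
      (prodBernoulli (fun x : Fin n => if x = o then (1 : unitInterval) else w s(par x, x))).real
        {ω' : Set (Fin n) | {a | a = o ∨ ∀ i, i ≤ depth a → par^[i] a ∈ ω'} ∈ S} := by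
  set μ := prodBernoulli w with hμ
  set q : Fin n → unitInterval := fun x => if x = o then 1 else w s(par x, x) with hq
  -- parent pairs are distinct (the spider lemma with a single dummy leg)
  have hginj : ∀ x y, x ≠ o → y ≠ o → s(par x, x) = s(par y, y) → x = y := fun x y hx hy h =>
    spider_gate_injective o (fun _ => ()) depth par hroot
      (fun z hz hd => ⟨(hstep z hz hd).1, rfl, (hstep z hz hd).2⟩) hx hy h
  have hanc : ∀ x, x ≠ o → ∀ i, i ≤ depth x → par^[i] x ≠ o := fun x hx i hi =>
    (tree_iterate_par o depth par hstep x hx i hi).1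
  -- good configurations (every open pair has nonzero weight) have full measure
  set G : Set (BondConfig (Fin n)) := {ω | ∀ e ∈ ω, w e ≠ 0} with hG
  have hGnull : μ.real Gᶜ = 0 := by
    set Z : Finset (Sym2 (Fin n)) := univ.filter (fun e => w e = 0) with hZ
    have hsub : Gᶜ ⊆ {ω : Set (Sym2 (Fin n)) | ∃ e ∈ Z, e ∈ ω} := by
      intro ω hω
      have hω' : ¬ ∀ e ∈ ω, w e ≠ 0 := hω
      push Not at hω'
      obtain ⟨e, he, hwe⟩ := hω'
      exact ⟨e, Finset.mem_filter.2 ⟨Finset.mem_univ _, hwe⟩, he⟩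
    have h1 : μ.real {ω : Set (Sym2 (Fin n)) | ∃ e ∈ Z, e ∈ ω} ≤ ∑ e ∈ Z, (w e : ℝ) :=
      prodBernoulli_real_exists_mem_le_sum w Z
    have h2 : ∑ e ∈ Z, (w e : ℝ) = 0 := Finset.sum_eq_zero fun e he => by
      rw [Finset.mem_filter] at he
      simp [he.2]
    exact le_antisymm ((measureReal_mono hsub (measure_ne_top _ _)).trans (h1.trans h2.le)) measureReal_nonneg
  have hcongr : ∀ X Y : Set (BondConfig (Fin n)), (∀ ω ∈ G, ω ∈ X ↔ ω ∈ Y) → μ.real X = μ.real Y := by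
    have key : ∀ X Y : Set (BondConfig (Fin n)), (∀ ω ∈ G, ω ∈ X → ω ∈ Y) → μ.real X ≤ μ.real Y := by
      intro X Y h
      have hsub : X ⊆ Y ∪ Gᶜ := fun ω hω => by
        by_cases hωG : ω ∈ G
        · exact Or.inl (h ω hωG hω)
        · exact Or.inr hωG
      calc μ.real X ≤ μ.real (Y ∪ Gᶜ) := measureReal_mono hsub (measure_ne_top _ _)
        _ ≤ μ.real Y + μ.real Gᶜ := measureReal_union_le _ _
        _ = μ.real Y := by rw [hGnull, add_zero]
    intro X Y h
    exact le_antisymm (key X Y fun ω hω => (h ω hω).1) (key Y X fun ω hω => (h ω hω).2)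
  -- on a good configuration every open non-loop pair is a parent pair
  have hgood : ∀ ω ∈ G, ∀ u v, u ≠ v → s(u, v) ∈ ω → ∃ x, x ≠ o ∧ s(u, v) = s(par x, x) := by
    intro ω hω u v huv he
    rcases hsupp _ (hω _ he) with hd | h
    · exact absurd (Sym2.mk_isDiag_iff.1 hd) huv
    · exact h
  -- the gate reading (the root counts as an always-open gate) and the ancestral-line map
  set g : Fin n → Set (Sym2 (Fin n)) → Prop := fun x ω => x = o ∨ (x ≠ o ∧ s(par x, x) ∈ ω) with hg
  set R : BondConfig (Fin n) → Set (Fin n) := fun ω => {x | g x ω} with hR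
  set F : Set (Fin n) → Set (Fin n) := fun ω' => {a | a = o ∨ ∀ i, i ≤ depth a → par^[i] a ∈ ω'} with hF
  -- a.s. the cluster is the image of the reading
  have hclu : ∀ ω ∈ G, {a | ω ∈ openConn o a} = F (R ω) := by
    intro ω hω
    ext a
    simp only [Set.mem_setOf_eq, hF]
    by_cases hao : a = o
    · rw [hao]
      exact ⟨fun _ => Or.inl rfl, fun _ => SimpleGraph.Reachable.refl o⟩
    · have hiff : (∀ i, i ≤ depth a → par^[i] a ∈ R ω) ↔
          ∀ i, i ≤ depth a → s(par (par^[i] a), par^[i] a) ∈ ω := by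
        refine forall_congr' fun i => imp_congr_right fun hi => ?_
        have hne := hanc a hao i hi
        simp only [hR, hg, Set.mem_setOf_eq]
        exact ⟨fun h => h.elim (fun h' => absurd h' hne) And.right, fun h => Or.inr ⟨hne, h⟩⟩
      constructor
      · intro h
        right
        rw [hiff]
        have hr : (openGraph ω).Reachable o a := h
        obtain ⟨p⟩ := hr
        rcases openWalk_tree_invariant o depth par hroot hstep ω (hgood ω hω) o a p (Or.inl rfl) with h' | ⟨-, h'⟩
        · exact absurd h' hao
        · exact h'
      · intro h
        rcases h with h | h
        · exact absurd h hao
        · rw [hiff] at h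
          exact mem_openConn_of_tree_gates o depth par hroot hstep ω a hao h
  -- the reading is product Bernoulli with parameters `q`
  set blk : Sym2 (Fin n) → Fin n := fun e => if h : ∃ x, x ≠ o ∧ s(par x, x) = e then Classical.choose h else o
    with hblk
  have hblk' : ∀ x, x ≠ o → blk s(par x, x) = x := by
    intro x hxo
    have hex : ∃ x', x' ≠ o ∧ s(par x', x') = s(par x, x) := ⟨x, hxo, rfl⟩
    have : blk s(par x, x) = Classical.choose hex := by simp only [hblk]; rw [dif_pos hex]
    rw [this]
    exact hginj _ _ (Classical.choose_spec hex).1 hxo (Classical.choose_spec hex).2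
  have hloc : IsBlockLocal blk g := by
    intro x ω ω' hagree
    by_cases hxo : x = o
    · simp only [hg, hxo, true_or]
    · exact or_congr Iff.rfl (and_congr Iff.rfl (hagree _ (hblk' x hxo)))
  have hmeasg : ∀ x, Measurable (g x) := fun x => Measurable.of_discrete
  have hq' : ∀ x, μ.real {ω | g x ω} = q x := by
    intro x
    by_cases hxo : x = o
    · have : {ω : Set (Sym2 (Fin n)) | g x ω} = Set.univ := Set.eq_univ_of_forall fun ω => Or.inl hxo
      rw [this, probReal_univ]
      simp [hq, hxo]
    · have : {ω : Set (Sym2 (Fin n)) | g x ω} = {ω | s(par x, x) ∈ ω} := by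
        ext ω
        simp only [hg, Set.mem_setOf_eq, hxo, false_or, ne_eq, not_false_eq_true, true_and]
      rw [this, hμ, prodBernoulli_real_setOf_mem]
      simp [hq, hxo]
  have hread : ∀ T : Set (Set (Fin n)), μ.real (R ⁻¹' T) = (prodBernoulli q).real T := fun T =>
    prodBernoulli_real_preimage_readBlocks w blk hloc hmeasg q hq' MeasurableSet.of_discrete
  -- assemble
  calc μ.real {ω : BondConfig (Fin n) | {a | ω ∈ openConn o a} ∈ S}
      = μ.real (R ⁻¹' (F ⁻¹' S)) := hcongr _ _ fun ω hω => by
          simp only [Set.mem_setOf_eq, Set.mem_preimage]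
          rw [hclu ω hω]
    _ = (prodBernoulli q).real (F ⁻¹' S) := hread _
    _ = (prodBernoulli q).real {ω' : Set (Fin n) | {a | a = o ∨ ∀ i, i ≤ depth a → par^[i] a ∈ ω'} ∈ S} := rfl

/-- **Connection probability on a tree is the product of the weights along the path.**  For tree-supported weights and `a ≠ o`:
`P_w(o ↔ a) = ∏_{i ≤ depth a} w s(par^[i+1] a, par^[i] a)`. [this work] -/
theorem tree_real_openConn_eq_prod (n : ℕ) (w : Sym2 (Fin n) → unitInterval) (o : Fin n) (depth : Fin n → ℕ)
    (par : Fin n → Fin n)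
    (hroot : ∀ x, x ≠ o → depth x = 0 → par x = o)
    (hstep : ∀ x, x ≠ o → depth x ≠ 0 → par x ≠ o ∧ depth (par x) + 1 = depth x)
    (hsupp : ∀ e, w e ≠ 0 → e.IsDiag ∨ ∃ x, x ≠ o ∧ e = s(par x, x))
    (a : Fin n) (hao : a ≠ o) :
    (prodBernoulli w).real (openConn o a) =
      ∏ i ∈ Finset.range (depth a + 1), (w s(par (par^[i] a), par^[i] a) : ℝ) := by
  set q : Fin n → unitInterval := fun x => if x = o then 1 else w s(par x, x) with hq
  have hanc := tree_iterate_par o depth par hstep a hao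
  have h1 := tree_cluster_transfer n w o depth par hroot hstep hsupp {C | a ∈ C}
  have hL : {ω : BondConfig (Fin n) | {a' | ω ∈ openConn o a'} ∈ {C : Set (Fin n) | a ∈ C}} = openConn o a := by
    ext ω
    simp only [Set.mem_setOf_eq]
  rw [hL] at h1
  rw [h1]
  -- the ancestral line as a finset
  set T : Finset (Fin n) := (Finset.range (depth a + 1)).image (fun i => par^[i] a) with hT
  have hinjT : Set.InjOn (fun i => par^[i] a) ↑(Finset.range (depth a + 1)) := by
    intro i hi i' hi' h
    have hi1 : i ≤ depth a := by
      have := Finset.mem_range.1 (Finset.mem_coe.1 hi); omega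
    have hi2 : i' ≤ depth a := by
      have := Finset.mem_range.1 (Finset.mem_coe.1 hi'); omega
    have e1 := (hanc i hi1).2
    have e2 := (hanc i' hi2).2
    have : depth (par^[i] a) = depth (par^[i'] a) := by
      show depth ((fun i => par^[i] a) i) = depth ((fun i => par^[i] a) i')
      rw [h]
    omega
  have hR : {ω' : Set (Fin n) | {a' | a' = o ∨ ∀ i, i ≤ depth a' → par^[i] a' ∈ ω'} ∈ {C : Set (Fin n) | a ∈ C}} =
      {ω' | ((T : Finset (Fin n)) : Set (Fin n)) ⊆ ω'} := by
    ext ω'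
    simp only [Set.mem_setOf_eq, hao, false_or, hT, Finset.coe_image, Finset.coe_range, Set.image_subset_iff]
    constructor
    · intro h i hi
      exact h i (by simpa [Nat.lt_succ_iff] using hi)
    · intro h i hi
      exact h (show i ∈ Set.Iio (depth a + 1) by simpa [Nat.lt_succ_iff] using hi)
  rw [hR, prodBernoulli_real_subset, hT, Finset.prod_image hinjT]
  refine Finset.prod_congr rfl fun i hi => ?_
  have hne := (hanc i (by have := Finset.mem_range.1 hi; omega)).1
  simp [hne]

/-- **Relay-count transfer on trees (the shape of the lane's rows).**  For tree-supported weights, every `A` and `j`: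
`P_w(#{a ∈ A | o ↔ a} ≤ j) = P_q(#{a ∈ A | a = o ∨ ∀ i ≤ depth a, par^[i] a ∈ ω'} ≤ j)` — so any gate-coordinate bound for the
right-hand side (e.g. a future FAR-on-trees theorem in the setting of `Quant.far_indepLegs`) is the same bound for `prodBernoulli w`.
[this work] -/
theorem tree_relayCount_transfer (n : ℕ) (w : Sym2 (Fin n) → unitInterval) (o : Fin n) (depth : Fin n → ℕ)
    (par : Fin n → Fin n)
    (hroot : ∀ x, x ≠ o → depth x = 0 → par x = o)
    (hstep : ∀ x, x ≠ o → depth x ≠ 0 → par x ≠ o ∧ depth (par x) + 1 = depth x)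
    (hsupp : ∀ e, w e ≠ 0 → e.IsDiag ∨ ∃ x, x ≠ o ∧ e = s(par x, x))
    (A : Finset (Fin n)) (j : ℕ) :
    (prodBernoulli w).real {ω : BondConfig (Fin n) | (A.filter fun a => ω ∈ openConn o a).card ≤ j} =
      (prodBernoulli (fun x : Fin n => if x = o then (1 : unitInterval) else w s(par x, x))).real
        {ω' : Set (Fin n) | (A.filter fun a => a = o ∨ ∀ i, i ≤ depth a → par^[i] a ∈ ω').card ≤ j} := by
  have h1 := tree_cluster_transfer n w o depth par hroot hstep hsupp
    {C : Set (Fin n) | (A.filter fun a => a ∈ C).card ≤ j}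
  have hL : {ω : BondConfig (Fin n) | {a' | ω ∈ openConn o a'} ∈ {C : Set (Fin n) | (A.filter fun a => a ∈ C).card ≤ j}} =
      {ω : BondConfig (Fin n) | (A.filter fun a => ω ∈ openConn o a).card ≤ j} := by
    ext ω
    simp only [Set.mem_setOf_eq]
  have hR : {ω' : Set (Fin n) | {a' | a' = o ∨ ∀ i, i ≤ depth a' → par^[i] a' ∈ ω'} ∈
        {C : Set (Fin n) | (A.filter fun a => a ∈ C).card ≤ j}} =
      {ω' : Set (Fin n) | (A.filter fun a => a = o ∨ ∀ i, i ≤ depth a → par^[i] a ∈ ω').card ≤ j} := by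
    ext ω'
    simp only [Set.mem_setOf_eq]
  rw [hL, hR] at h1
  exact h1

end Quant

end Summit.CriticalPhenomena.PercolationContinuityZ3.Theorems

end
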